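import Mathlib.MeasureTheory.Measure.Portmanteau
import Mathlib.MeasureTheory.Measure.LevyProkhorovMetric
import Literature.Probability.Percolation.OneArmScalingLimit
import HarnessLib

/-!
# Arc couplings at subsequential limits: closed inclusion events and the portmanteau transfer (proofs only)

Topic `Probability/Percolation`; family `crit-perc`. Def-free, fact-free. In §2 of Lawler–Schramm–
Werner, *One-arm exponent for critical 2D percolation*, Electron. J. Probab. **7** (2002), paper
no. 2, the arc hulls `Q(θ) ⊆ Q(2π)` of the scaling limit are used jointly (pp. 3–7): `Q(θ)`
increases with the arc, and `Q' = Q(2π) ∖ Q(θ)` is small with high probability, (2.14)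
`P[diam Q' ≥ r] ≤ c (ε/r)^{1+α}`, "by letting `δ ↓ 0`" in the discrete three-arm bound (2.13). In
the tree the scaling limit is handled through subsequential weak limits `ν` of the hull laws
`lswLaw R` on the Hausdorff space `NonemptyCompacts ℂ`, and the renewal line
(`OneArmNeumannCoupling.lean`, `renewal_hypotheses_of_arcCoupling`) consumes, for each `θ`, a
coupling `μ_θ` of `(K_θ, K_{2π})` on `NonemptyCompacts ℂ × NonemptyCompacts ℂ` with second marginal
`ν`, `K_θ ⊆ K_{2π}` a.s. and the tail `μ_θ{K_{2π} ⊄ K_θ ∪ B̄(1, r)} ≤ c ((2π - θ)/r)^γ`. This file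
proves that these three properties pass from any approximating sequence of pair laws (e.g. the
joint laws of `(Q_δ(θ), Q_δ(2π))` along `δ_k = 1/R_k`) to their weak limit:

* `isClosed_setOf_fst_subset_snd_union`, `isClosed_setOf_snd_subset_fst_union` — for closed
  `C ⊆ ℂ`, the inclusion events `{(A, B) | A ⊆ B ∪ C}` and `{(A, B) | B ⊆ A ∪ C}` are closed in
  `NonemptyCompacts ℂ × NonemptyCompacts ℂ` (Hausdorff convergence: a point of the limit set is a
  limit of points of the approximating sets; `C = ∅` gives `{A ⊆ B}`, `isClosed_setOf_fst_subset_snd`);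
* `ae_fst_subset_snd_of_tendsto` — if `P_k → μ` weakly and `A ⊆ B` `P_k`-a.s. for all `k`, then
  `A ⊆ B` `μ`-a.s. (portmanteau, closed sets);
* `measureReal_not_snd_subset_fst_union_le_of_tendsto` — if `P_k → μ` weakly and eventually
  `P_k{B ⊄ A ∪ B̄(z, r)} ≤ b`, then `μ{B ⊄ A ∪ B̄(z, r)} ≤ b` (portmanteau, open sets): LSW's
  "by letting `δ ↓ 0`, it follows from (2.13) that (2.14)";
* `map_snd_eq_of_tendsto` — if `P_k → μ` and the second marginals `P_k ∘ snd⁻¹` converge to `ν`,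
  then `μ ∘ snd⁻¹ = ν` (continuity of push-forwards, uniqueness of weak limits);
* `arcCoupling_of_tendsto` — the three together, in the shape consumed by
  `renewal_hypotheses_of_arcCoupling`.

No new definitions, no named facts.

## References

* G. F. Lawler, O. Schramm, W. Werner, *One-arm exponent for critical 2D percolation*, Electron.
  J. Probab. 7 (2002), no. 2, §2: p. 3 (the law of `Q_δ(θ)` on the Hausdorff space), (2.13)–(2.14)
  (p. 6) [LawlerSchrammWernerEJP2002].
* P. Billingsley, *Convergence of Probability Measures*, 2nd ed. (1999), Thm. 2.1 (portmanteau)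
  [Billingsley1999].

## Mathlib / tree

Mathlib: `ProbabilityMeasure.limsup_measure_closed_le_of_tendsto`,
`ProbabilityMeasure.le_liminf_measure_open_of_tendsto`,
`ProbabilityMeasure.tendsto_map_of_tendsto_of_continuous`, `tendsto_nhds_unique`,
`IsSeqClosed.isClosed`, `IsCompact.exists_infDist_eq_dist`, `Metric.infDist_le_hausdorffDist_of_mem`,
`IsClosed.mem_of_frequently_of_tendsto`. Tree: the Borel structure on `NonemptyCompacts ℂ`
(`OneArmScalingLimit.lean`).
-/

noncomputable section

open MeasureTheory Filter Topology Set Metric TopologicalSpace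
open scoped ENNReal NNReal

namespace Literature.Probability.Percolation

/-! ### Closed inclusion events in the product of Hausdorff spaces -/

/-- **`{(A, B) | A ⊆ B ∪ C}` is closed** in `NonemptyCompacts ℂ × NonemptyCompacts ℂ` for closed
`C`: if `(A_n, B_n) → (A, B)` in the Hausdorff metric with `A_n ⊆ B_n ∪ C` and `a ∈ A`, pick
`a_n ∈ A_n` with `a_n → a`; either `a_n ∈ C` frequently, and `a ∈ C`, or `a_n ∈ B_n` eventually,
and `dist(a, B) ≤ dist(a, a_n) + d_H(B_n, B) → 0`, so `a ∈ B`. [folklore] -/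
theorem isClosed_setOf_fst_subset_snd_union {C : Set ℂ} (hC : IsClosed C) :
    IsClosed {p : NonemptyCompacts ℂ × NonemptyCompacts ℂ |
      ((p.1 : NonemptyCompacts ℂ) : Set ℂ) ⊆ (p.2 : Set ℂ) ∪ C} := by
  refine IsSeqClosed.isClosed fun u p hu hup ↦ ?_
  intro a ha
  have h1 : Tendsto (fun n ↦ (u n).1) atTop (𝓝 p.1) := (continuous_fst.tendsto p).comp hup
  have h2 : Tendsto (fun n ↦ (u n).2) atTop (𝓝 p.2) := (continuous_snd.tendsto p).comp hup
  -- approximating points `a_n ∈ A_n`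
  have hex : ∀ n, ∃ y ∈ ((u n).1 : Set ℂ), infDist a ((u n).1 : Set ℂ) = dist a y := fun n ↦
    (u n).1.isCompact.exists_infDist_eq_dist (u n).1.nonempty a
  choose an han hdist using hex
  have hconv : Tendsto an atTop (𝓝 a) := by
    rw [tendsto_iff_dist_tendsto_zero]
    have hd1 : Tendsto (fun n ↦ dist (u n).1 p.1) atTop (𝓝 0) := (tendsto_iff_dist_tendsto_zero.1 h1)
    refine squeeze_zero (fun n ↦ dist_nonneg) (fun n ↦ ?_) hd1
    rw [dist_comm, ← hdist n, NonemptyCompacts.dist_eq, hausdorffDist_comm]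
    exact infDist_le_hausdorffDist_of_mem ha
      (hausdorffEDist_ne_top_of_nonempty_of_bounded p.1.nonempty (u n).1.nonempty
        p.1.isCompact.isBounded (u n).1.isCompact.isBounded)
  by_cases hfreq : ∃ᶠ n in atTop, an n ∈ C
  · exact Or.inr (hC.mem_of_frequently_of_tendsto hfreq hconv)
  · left
    have hev : ∀ᶠ n in atTop, an n ∈ ((u n).2 : Set ℂ) := by
      have hnot : ∀ᶠ n in atTop, an n ∉ C := not_frequently.1 hfreq
      filter_upwards [hnot] with n hn
      exact (hu n (han n)).resolve_right hn
    have hbound : ∀ᶠ n in atTop, infDist a ((p.2 : NonemptyCompacts ℂ) : Set ℂ) ≤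
        dist (an n) a + dist (u n).2 p.2 := by
      filter_upwards [hev] with n hn
      calc infDist a ((p.2 : NonemptyCompacts ℂ) : Set ℂ)
          ≤ infDist (an n) ((p.2 : NonemptyCompacts ℂ) : Set ℂ) + dist a (an n) := infDist_le_infDist_add_dist
        _ ≤ hausdorffDist ((u n).2 : Set ℂ) ((p.2 : NonemptyCompacts ℂ) : Set ℂ) + dist a (an n) := by
            gcongr
            exact infDist_le_hausdorffDist_of_mem hn
              (hausdorffEDist_ne_top_of_nonempty_of_bounded (u n).2.nonempty p.2.nonempty
                (u n).2.isCompact.isBounded p.2.isCompact.isBounded)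
        _ = dist (an n) a + dist (u n).2 p.2 := by rw [NonemptyCompacts.dist_eq, dist_comm a]; ring
    have hlim : Tendsto (fun n ↦ dist (an n) a + dist (u n).2 p.2) atTop (𝓝 0) := by
      have := (tendsto_iff_dist_tendsto_zero.1 hconv).add (tendsto_iff_dist_tendsto_zero.1 h2)
      rwa [add_zero] at this
    have h0 : infDist a ((p.2 : NonemptyCompacts ℂ) : Set ℂ) ≤ 0 := ge_of_tendsto hlim hbound
    have h00 : infDist a ((p.2 : NonemptyCompacts ℂ) : Set ℂ) = 0 := le_antisymm h0 infDist_nonneg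
    exact (p.2.isCompact.isClosed.mem_iff_infDist_zero p.2.nonempty).2 h00

/-- **`{(A, B) | B ⊆ A ∪ C}` is closed** for closed `C` (swap the factors). [folklore] -/
theorem isClosed_setOf_snd_subset_fst_union {C : Set ℂ} (hC : IsClosed C) :
    IsClosed {p : NonemptyCompacts ℂ × NonemptyCompacts ℂ |
      ((p.2 : NonemptyCompacts ℂ) : Set ℂ) ⊆ (p.1 : Set ℂ) ∪ C} := by
  exact (isClosed_setOf_fst_subset_snd_union hC).preimage continuous_swap

/-- **`{(A, B) | A ⊆ B}` is closed** (`C = ∅`). [folklore] -/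
theorem isClosed_setOf_fst_subset_snd :
    IsClosed {p : NonemptyCompacts ℂ × NonemptyCompacts ℂ |
      ((p.1 : NonemptyCompacts ℂ) : Set ℂ) ⊆ (p.2 : Set ℂ)} := by
  have := isClosed_setOf_fst_subset_snd_union (C := (∅ : Set ℂ)) isClosed_empty
  simpa using this

/-! ### The portmanteau transfer -/

variable {P : ℕ → ProbabilityMeasure (NonemptyCompacts ℂ × NonemptyCompacts ℂ)}
  {μ : ProbabilityMeasure (NonemptyCompacts ℂ × NonemptyCompacts ℂ)}

/-- **A.s. inclusion passes to the weak limit**: if `P_k → μ` weakly and `A ⊆ B` holds `P_k`-a.s.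
for every `k`, then `A ⊆ B` holds `μ`-a.s. (the event is closed, so
`μ{A ⊆ B} ≥ limsup P_k{A ⊆ B} = 1`). [cite: Billingsley1999, Thm. 2.1] -/
theorem ae_fst_subset_snd_of_tendsto (hP : Tendsto P atTop (𝓝 μ))
    (hsub : ∀ k, ∀ᵐ p ∂(P k : Measure (NonemptyCompacts ℂ × NonemptyCompacts ℂ)),
      ((p.1 : NonemptyCompacts ℂ) : Set ℂ) ⊆ (p.2 : Set ℂ)) :
    ∀ᵐ p ∂(μ : Measure (NonemptyCompacts ℂ × NonemptyCompacts ℂ)),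
      ((p.1 : NonemptyCompacts ℂ) : Set ℂ) ⊆ (p.2 : Set ℂ) := by
  set F := {p : NonemptyCompacts ℂ × NonemptyCompacts ℂ |
    ((p.1 : NonemptyCompacts ℂ) : Set ℂ) ⊆ (p.2 : Set ℂ)} with hF
  have hFc : IsClosed F := isClosed_setOf_fst_subset_snd
  have hone : ∀ k, (P k : Measure (NonemptyCompacts ℂ × NonemptyCompacts ℂ)) F = 1 := by
    intro k
    have h0 : (P k : Measure (NonemptyCompacts ℂ × NonemptyCompacts ℂ)) Fᶜ = 0 := by
      have := hsub k
      rw [ae_iff] at this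
      exact this
    have := measure_add_measure_compl (μ := (P k : Measure (NonemptyCompacts ℂ × NonemptyCompacts ℂ)))
      hFc.measurableSet
    rw [h0, add_zero, measure_univ] at this
    exact this
  have hlimsup := ProbabilityMeasure.limsup_measure_closed_le_of_tendsto hP hFc
  have hlimsup1 : atTop.limsup (fun k ↦ (P k : Measure (NonemptyCompacts ℂ × NonemptyCompacts ℂ)) F) = 1 := by
    simp_rw [hone]
    exact limsup_const 1
  rw [hlimsup1] at hlimsup
  have hμF : (μ : Measure (NonemptyCompacts ℂ × NonemptyCompacts ℂ)) F = 1 :=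
    le_antisymm prob_le_one hlimsup
  rw [ae_iff]
  have := measure_add_measure_compl (μ := (μ : Measure (NonemptyCompacts ℂ × NonemptyCompacts ℂ)))
    hFc.measurableSet
  rw [hμF, measure_univ] at this
  -- `1 + μ Fᶜ = 1 = 1 + 0`
  have hsum : 1 + (μ : Measure (NonemptyCompacts ℂ × NonemptyCompacts ℂ)) Fᶜ = 1 + 0 := by
    rw [add_zero]; exact this
  exact (ENNReal.add_right_inj ENNReal.one_ne_top).1 hsum

/-- **Tail bounds pass to the weak limit** ("by letting `δ ↓ 0`, it follows from (2.13) that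
(2.14)"): if `P_k → μ` weakly and eventually `P_k{B ⊄ A ∪ B̄(z, r)} ≤ b`, then
`μ{B ⊄ A ∪ B̄(z, r)} ≤ b` (the event is open, so `μ(·) ≤ liminf P_k(·)`).
[cite: LawlerSchrammWernerEJP2002, (2.13)–(2.14) (p. 6)] [cite: Billingsley1999, Thm. 2.1] -/
theorem measureReal_not_snd_subset_fst_union_le_of_tendsto (hP : Tendsto P atTop (𝓝 μ))
    {z : ℂ} {r b : ℝ}
    (htail : ∀ᶠ k in atTop, (P k : Measure (NonemptyCompacts ℂ × NonemptyCompacts ℂ)).real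
      {p | ¬ (((p.2 : NonemptyCompacts ℂ) : Set ℂ) ⊆ (p.1 : Set ℂ) ∪ closedBall z r)} ≤ b) :
    (μ : Measure (NonemptyCompacts ℂ × NonemptyCompacts ℂ)).real
      {p | ¬ (((p.2 : NonemptyCompacts ℂ) : Set ℂ) ⊆ (p.1 : Set ℂ) ∪ closedBall z r)} ≤ b := by
  set G := {p : NonemptyCompacts ℂ × NonemptyCompacts ℂ |
    ¬ (((p.2 : NonemptyCompacts ℂ) : Set ℂ) ⊆ (p.1 : Set ℂ) ∪ closedBall z r)} with hG
  have hGo : IsOpen G :=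
    (isClosed_setOf_snd_subset_fst_union (C := closedBall z r) isClosed_closedBall).isOpen_compl
  have hliminf := ProbabilityMeasure.le_liminf_measure_open_of_tendsto hP hGo
  -- `b ≥ 0` (eventually a probability is `≤ b`)
  obtain ⟨k₀, hk₀⟩ := htail.exists
  have hb : 0 ≤ b := measureReal_nonneg.trans hk₀
  -- pass to `ℝ≥0∞`
  have hev : ∀ᶠ k in atTop, (P k : Measure (NonemptyCompacts ℂ × NonemptyCompacts ℂ)) G ≤ ENNReal.ofReal b := by
    filter_upwards [htail] with k hk
    rw [← ENNReal.ofReal_toReal (measure_ne_top _ G)]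
    exact ENNReal.ofReal_le_ofReal hk
  have hlim_le : atTop.liminf (fun k ↦ (P k : Measure (NonemptyCompacts ℂ × NonemptyCompacts ℂ)) G) ≤
      ENNReal.ofReal b :=
    liminf_le_of_frequently_le (Eventually.frequently hev) (by isBoundedDefault)
  have hμG : (μ : Measure (NonemptyCompacts ℂ × NonemptyCompacts ℂ)) G ≤ ENNReal.ofReal b :=
    hliminf.trans hlim_le
  rw [Measure.real, ← ENNReal.toReal_ofReal hb]
  exact ENNReal.toReal_mono ENNReal.ofReal_ne_top hμG

/-- **Second marginals pass to the weak limit**: if `P_k → μ` weakly and the second marginals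
`P_k ∘ snd⁻¹` converge weakly to `ν`, then `μ ∘ snd⁻¹ = ν`. [cite: Billingsley1999, Thm. 2.1 and Thm. 2.7 (continuous mapping)] -/
theorem map_snd_eq_of_tendsto (hP : Tendsto P atTop (𝓝 μ)) {ν : ProbabilityMeasure (NonemptyCompacts ℂ)}
    (hsnd : Tendsto (fun k ↦ (P k).map (f := Prod.snd) continuous_snd.measurable.aemeasurable) atTop (𝓝 ν)) :
    (μ : Measure (NonemptyCompacts ℂ × NonemptyCompacts ℂ)).map Prod.snd = ν := by
  have hcont := ProbabilityMeasure.tendsto_map_of_tendsto_of_continuous P μ hP continuous_snd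
  have heq : μ.map continuous_snd.measurable.aemeasurable = ν := tendsto_nhds_unique hcont hsnd
  have := congrArg (fun ρ : ProbabilityMeasure (NonemptyCompacts ℂ) ↦ (ρ : Measure (NonemptyCompacts ℂ))) heq
  simpa using this

/-- **Arc couplings from approximating pair laws.** If `P_k → μ` weakly on
`NonemptyCompacts ℂ × NonemptyCompacts ℂ`, `A ⊆ B` `P_k`-a.s., the second marginals of `P_k`
converge to `ν`, and for every `r > 0` eventually `P_k{B ⊄ A ∪ B̄(1, r)} ≤ τ(r)`, then `μ` is a
coupling with second marginal `ν`, `A ⊆ B` a.s. and tails `μ{B ⊄ A ∪ B̄(1, r)} ≤ τ(r)` — the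
per-`θ` input of `renewal_hypotheses_of_arcCoupling` (with `τ(r) = c ((2π - θ)/r)^γ`), apart from
(2.10). [cite: LawlerSchrammWernerEJP2002, §2 (p. 3), (2.13)–(2.14) (p. 6)] -/
theorem arcCoupling_of_tendsto (hP : Tendsto P atTop (𝓝 μ)) {ν : ProbabilityMeasure (NonemptyCompacts ℂ)}
    (hsnd : Tendsto (fun k ↦ (P k).map (f := Prod.snd) continuous_snd.measurable.aemeasurable) atTop (𝓝 ν))
    (hsub : ∀ k, ∀ᵐ p ∂(P k : Measure (NonemptyCompacts ℂ × NonemptyCompacts ℂ)),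
      ((p.1 : NonemptyCompacts ℂ) : Set ℂ) ⊆ (p.2 : Set ℂ))
    {τ : ℝ → ℝ}
    (htail : ∀ r : ℝ, 0 < r → ∀ᶠ k in atTop, (P k : Measure (NonemptyCompacts ℂ × NonemptyCompacts ℂ)).real
      {p | ¬ (((p.2 : NonemptyCompacts ℂ) : Set ℂ) ⊆ (p.1 : Set ℂ) ∪ closedBall (1 : ℂ) r)} ≤ τ r) :
    (μ : Measure (NonemptyCompacts ℂ × NonemptyCompacts ℂ)).map Prod.snd = ν ∧
    (∀ᵐ p ∂(μ : Measure (NonemptyCompacts ℂ × NonemptyCompacts ℂ)),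
      ((p.1 : NonemptyCompacts ℂ) : Set ℂ) ⊆ (p.2 : Set ℂ)) ∧
    ∀ r : ℝ, 0 < r → (μ : Measure (NonemptyCompacts ℂ × NonemptyCompacts ℂ)).real
      {p | ¬ (((p.2 : NonemptyCompacts ℂ) : Set ℂ) ⊆ (p.1 : Set ℂ) ∪ closedBall (1 : ℂ) r)} ≤ τ r :=
  ⟨map_snd_eq_of_tendsto hP hsnd, ae_fst_subset_snd_of_tendsto hP hsub,
    fun r hr ↦ measureReal_not_snd_subset_fst_union_le_of_tendsto hP (htail r hr)⟩

end Literature.Probability.Percolation
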